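import Mathlib
import Literature.Probability.Percolation.ArmEvents
import Literature.Probability.Percolation.TwoPointFunction
import Literature.Probability.Percolation.CriticalContinuity
import Summits.CriticalPhenomena.PercolationContinuityZ3.Theses.PercShatteringRace

/-!
# Sketch — crux-ideate stmt-CriticalPhenomena-5786 (FreeSusceptibilityPowerSaving), ideator 3

First lemmas of the two idea cards, stated over existing declarations (elaboration check only;
nothing is proved here).  Crux (route decl, FIXED):
`Summit.CriticalPhenomena.PercolationContinuityZ3.Theses.PercShatteringRace.FreeSusceptibilityPowerSaving`
= `∃ C, ∀ R ≥ 1, Σ_{y ∈ box 3 R} P_{p_c}(0 ↔ y inside box 3 R) ≤ C R^{5/2}`.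
-/

namespace Summit.CriticalPhenomena.PercolationContinuityZ3.Cruxes.FreeSusceptibilityPowerSaving.Sketch

open Literature.Probability.Percolation Literature.Probability.LatticeModels
open scoped BigOperators

noncomputable section

/-- The critical bond measure on `ℤ³`. -/
abbrev μc : MeasureTheory.Measure (BondConfig (Site 3)) :=
  bondPercolation (zdGraph 3) (criticalProbI 3)

/-- In-box (free-boundary) connectivity of the centre: `τ^{Λ_R}(0,y) = P_{p_c}(0 ↔ y inside box 3 R)`. -/
def tauBox (R : ℕ) (y : Site 3) : ℝ :=
  μc.real (openConnIn (↑(box 3 R) : Set (Site 3)) 0 y)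

/-- Two-replica in-box connectivity `u_R(y) = τ^{Λ_R}(0,y)²` (probability that two INDEPENDENT
critical configurations both connect `0` to `y` inside the free box). -/
def uBox (R : ℕ) (y : Site 3) : ℝ := tauBox R y ^ 2

/-! ## Card A — replica-rerouting-free-dirichlet -/

/-- **(A, target form C⁺) TwoReplicaHarmonicDomination = RR(C₀, r₀).**  The squared in-box
connection probability is dominated, up to a constant `C₀`, by EVERY function that is
lattice-harmonic on the annular region `box R \ box r₀`, majorises `u_R` on the core `box r₀`
and is non-negative off `box R` (where `u_R` vanishes identically: Dirichlet data for free).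
Equivalently `u_R(x) ≤ C₀ · E_x[u_R(X_T)]`, `X` = SRW from `x`, `T` = hitting time of
`box r₀ ∪ (ℤ³ \ box R)`.  With `C₀ = 1` this would follow from pointwise subharmonicity
(maximum principle); the card's point is that a CONSTANT suffices for the crux. -/
def TwoReplicaHarmonicDomination : Prop :=
  ∃ (C₀ : ℝ) (r₀ : ℕ), ∀ R : ℕ, r₀ < R → ∀ h : Site 3 → ℝ,
    (∀ y ∈ box 3 R, y ∉ box 3 r₀ →
        h y = (1 / 6 : ℝ) * ∑ i : Fin 3, (h (y + Pi.single i 1) + h (y - Pi.single i 1))) →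
    (∀ y ∈ box 3 r₀, uBox R y ≤ h y) →
    (∀ y : Site 3, y ∉ box 3 R → 0 ≤ h y) →
    ∀ x ∈ box 3 R, x ∉ box 3 r₀ → uBox R x ≤ C₀ * h x

/-- **(A, first lemma, consequence) InBoxSqrtGreenDecay.**  Square-root-Gaussian decay of the
in-box connectivity: `τ^{Λ_R}(0,x)² ≤ C/‖x‖∞` for `x ≠ 0`, uniformly in `R`
(η_box ≥ −1/2 = −(d−2)/2).  Truth: `τ² ≍ ‖x‖^{-1.91}`. -/
def InBoxSqrtGreenDecay : Prop :=
  ∃ C : ℝ, ∀ R : ℕ, ∀ x ∈ box 3 R, x ≠ 0 → uBox R x ≤ C / ‖x‖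

/-- **(A1, provable now — lattice potential theory).**  Test `TwoReplicaHarmonicDomination`
against `h = G(·)/min_{box r₀} G`, `G` = SRW Green function of `ℤ³` (harmonic off `0`,
positive, `G(x) ≤ C/‖x‖`): gives `InBoxSqrtGreenDecay`. -/
def CardA_step1 : Prop := TwoReplicaHarmonicDomination → InBoxSqrtGreenDecay

/-- **(A2, provable now — a lattice sum).**  `Σ_{x ∈ box 3 R, x ≠ 0} (C/‖x‖)^{1/2} ≤ C' R^{5/2}`
(shells: `#{‖x‖∞ = n} ≤ 26 n²`, `Σ_{n ≤ R} n² · n^{-1/2} ≤ R^{5/2}`), plus the `x = 0` term. -/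
def CardA_step2 : Prop :=
  InBoxSqrtGreenDecay →
    Summit.CriticalPhenomena.PercolationContinuityZ3.Theses.PercShatteringRace.FreeSusceptibilityPowerSaving

/-! ## Card B — aspect-fekete-quarter -/

/-- The aspect-`λ` annulus crossing event at scale `n` (free b.c. inside the big box):
some vertex of `box 3 n` is joined inside `box 3 (λ n)` to the inner vertex boundary of
`box 3 (λ n)`.  For `λ = 2` this is `Literature…SpanningClustersAboveSix.annulusCrossing 3 n`. -/
def annulusCrossingAt (lam n : ℕ) : Set (BondConfig (Site 3)) :=
  {ω | ∃ x ∈ box 3 n, ∃ y ∈ innerBoundary (zdGraph 3) (box 3 (lam * n)),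
      ω ∈ openConnIn (↑(box 3 (lam * n)) : Set (Site 3)) x y}

/-- **(B, target form C⁺) SingleAspectQuarter.**  ONE aspect ratio `λ ≥ 2` at which the critical
annulus-crossing probability is eventually `≤ λ^{-1/4}` (e.g. `λ = 2`: `≤ 0.8409`;
`λ = 256`: `≤ 1/4`).  Truth (hyperscaling, d = 3): `P ≍ λ^{-β/ν} = λ^{-0.477}`. -/
def SingleAspectQuarter : Prop :=
  ∃ lam n₀ : ℕ, 2 ≤ lam ∧ ∀ n : ℕ, n₀ ≤ n →
    μc.real (annulusCrossingAt lam n) ≤ (lam : ℝ) ^ (-(1 / 4 : ℝ))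

/-- **(B, intermediate) OneArmQuarter.**  One-arm decay with exponent `1/4` at `p_c(ℤ³)`
(truth `n^{-0.477}`; any rate at all is open and already implies `θ(p_c) = 0`). -/
def OneArmQuarter : Prop :=
  ∃ C : ℝ, ∀ n : ℕ, 1 ≤ n → oneArmProb 3 (criticalProbI 3) n ≤ C * (n : ℝ) ^ (-(1 / 4 : ℝ))

/-- **(B1, provable now — BK/Fekete in the aspect variable).**
`{0 ↔ ∂Λ_{λm}} ⊆ {0 ↔ ∂Λ_m} ∘ annulusCrossingAt λ m` (initial segment / segment after the last
visit to `Λ_m`, edge-disjoint), so `π(λ^{k+1} n₀) ≤ π(λ^k n₀) · λ^{-1/4}` (van den Berg–Kesten,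
`bk_finitary`), whence `π(n) ≤ C n^{-1/4}` by monotonicity of `π`. -/
def CardB_step1 : Prop := SingleAspectQuarter → OneArmQuarter

/-- **(B2, provable now — the lossless BK-midpoint currency).**  For `y ∈ box 3 R`, `y ≠ 0`,
`m = ⌊‖y‖∞/2⌋ - 1`: `{0 ↔ y in Λ_R} ⊆ {0 ↔ ∂Λ_m} ∩ {y ↔ y + ∂Λ_m}`, two events measurable with
respect to DISJOINT edge sets, hence independent: `τ^{Λ_R}(0,y) ≤ π(m)²`; then
`Σ_{y} π(⌊‖y‖/2⌋-1)² ≤ C Σ_{n ≤ R} n² n^{-1/2} ≤ C' R^{5/2}`. -/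
def CardB_step2 : Prop :=
  OneArmQuarter →
    Summit.CriticalPhenomena.PercolationContinuityZ3.Theses.PercShatteringRace.FreeSusceptibilityPowerSaving

/-- The aspect-2 instance with the explicit constant `2^{-1/4} > 0.84`:
`P_{p_c}(box 3 n ↔ ∂ⁱⁿ box 3 (2n) inside) ≤ 0.84` eventually already gives the crux. -/
def AspectTwoBelow084 : Prop :=
  ∃ n₀ : ℕ, ∀ n : ℕ, n₀ ≤ n → μc.real (annulusCrossingAt 2 n) ≤ (0.84 : ℝ)

/-- `AspectTwoBelow084 → SingleAspectQuarter` (since `0.84 ≤ 2^{-1/4} = 0.8409`). -/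
theorem aspectTwo_singleAspect (h : AspectTwoBelow084) : SingleAspectQuarter := by
  obtain ⟨n₀, hn⟩ := h
  refine ⟨2, n₀, le_rfl, fun n hnn => (hn n hnn).trans ?_⟩
  -- 0.84 ≤ 2^(-1/4): 0.84^4 = 0.4979 < 1/2
  rw [show ((2:ℕ):ℝ) = (2:ℝ) by norm_num]
  have h4 : (0.84 : ℝ) = ((0.84 : ℝ) ^ (4:ℝ)) ^ ((1/4 : ℝ)) := by
    rw [← Real.rpow_mul (by norm_num)]; norm_num
  have key : (0.84 : ℝ) ^ (4:ℝ) ≤ (2:ℝ)⁻¹ := by norm_num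
  calc (0.84 : ℝ) = ((0.84 : ℝ) ^ (4:ℝ)) ^ ((1/4 : ℝ)) := h4
    _ ≤ ((2:ℝ)⁻¹) ^ ((1/4 : ℝ)) := by
        apply Real.rpow_le_rpow (by positivity) key (by norm_num)
    _ = (2:ℝ) ^ (-(1/4 : ℝ)) := by
        rw [Real.inv_rpow (by norm_num), ← Real.rpow_neg (by norm_num)]

end

end Summit.CriticalPhenomena.PercolationContinuityZ3.Cruxes.FreeSusceptibilityPowerSaving.Sketch
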